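import Literature.Topology.PlaneTopology.JordanNesting
import Literature.Algebra.EuclideanLattices.LatticePointCounting
import HarnessLib

/-!
# The two sides of a Jordan loop at a point of the curve; loops in a conformal disc

Topic: Topology / PlaneTopology, sequel to `JordanSweepParity.lean` (`IsJordanLoop`, `inside`,
`outside`) and `JordanNesting.lean` (`frontier_inside = frontier_outside = range`). Three small
consequences of the Jordan curve theorem used by the chamber argument of the conformal boundary
hitting estimate (Lawler–Schramm–Werner, Ann. Probab. **32** (2004), proof of Lemma 5.4:
"`α' ⊂ K_3` separates `C(w, r/8)` from `∂D` in `K_3`"):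

* `IsJordanLoop.subset_inside_or_of_nhds` — **local two-sidedness**: if a neighbourhood `V` of a
  point `x` of the curve satisfies `V ∖ range γ ⊆ P ∪ P'` with `P, P'` preconnected and off
  the curve, then one of `P, P'` lies inside and the other outside the loop (both complementary
  components accumulate at `x`);
* `IsJordanLoop.inside_subset_interior_of_convex` — the inside of a loop lies in the interior of
  every closed convex set containing the curve (from `inside_subset_closure_convexHull`);
* `IsJordanLoop.inside_subset_of_leftInvOn` — **a Jordan loop in a conformal disc bounds inside
  it**: if `Ω = F(𝔻)` for a continuous `F` on the open unit disc with a continuous left inverse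
  `ψ : Ω → 𝔻`, then every Jordan loop in `Ω` has its inside in `Ω` (the winding number of the
  loop about a point `z ∉ Ω` vanishes because `F - z` has a continuous logarithm on the convex
  disc, `HasLogOn.of_homotopy`, while it is `≠ 0` about points of the inside,
  `mem_inside_iff_wind_ne_zero`);
* `IsJordanLoop.inter_range_nonempty_of_not_subset` — a preconnected set meeting the inside and
  not contained in it meets the curve.

All statements are [folklore].

## References

* G. F. Lawler, O. Schramm, W. Werner, Ann. Probab. 32 (2004), proof of Lemma 5.4.
  [LawlerSchrammWerner2004]
-/

noncomputable section

open Set Filter Metric Function Complex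
open _root_.Topology

namespace Literature.Topology.PlaneTopology

namespace IsJordanLoop

variable {γ : ℝ → ℂ}

/-! ### Two-sidedness at a point of the curve -/

/-- **Local two-sidedness of a Jordan loop.** Let `x` lie on the Jordan loop `γ`, let `V` be a
neighbourhood of `x`, and suppose `V ∖ range γ ⊆ P ∪ P'` with `P`, `P'` preconnected subsets of
the complement of the curve. Then `P` lies inside and `P'` outside, or the other way round.
(Each of `P, P'` lies in one complementary component; they cannot lie in the same one, since the
other component has `x` in its frontier and therefore meets `V` off the curve.) [folklore] -/
theorem subset_inside_or_of_nhds (h : IsJordanLoop γ) {x : ℂ} (hx : x ∈ range γ) {V P P' : Set ℂ}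
    (hV : V ∈ 𝓝 x) (hVPP : V \ range γ ⊆ P ∪ P') (hP : IsPreconnected P) (hP' : IsPreconnected P')
    (hPγ : P ⊆ (range γ)ᶜ) (hP'γ : P' ⊆ (range γ)ᶜ) :
    (P ⊆ inside γ ∧ P' ⊆ outside γ) ∨ (P ⊆ outside γ ∧ P' ⊆ inside γ) := by
  -- a component with `x` in its frontier meets `V` off the curve
  have hmeet : ∀ W : Set ℂ, frontier W = range γ → W ⊆ (range γ)ᶜ → (W ∩ (P ∪ P')).Nonempty := by
    intro W hW hWγ
    have hxW : x ∈ closure W := by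
      have : x ∈ frontier W := hW ▸ hx
      exact frontier_subset_closure this
    obtain ⟨y, hyV, hyW⟩ := mem_closure_iff_nhds.1 hxW V hV
    exact ⟨y, hyW, hVPP ⟨hyV, hWγ hyW⟩⟩
  rcases h.subset_inside_or_subset_outside hP hPγ with hPi | hPo <;>
    rcases h.subset_inside_or_subset_outside hP' hP'γ with hP'i | hP'o
  · -- both inside: the outside meets `P ∪ P' ⊆ inside`
    exfalso
    obtain ⟨y, hyo, hyPP⟩ := hmeet (outside γ) h.frontier_outside outside_subset_compl_range
    have hyi : y ∈ inside γ := hyPP.elim (fun hy ↦ hPi hy) (fun hy ↦ hP'i hy)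
    exact Set.disjoint_left.1 disjoint_inside_outside hyi hyo
  · exact Or.inl ⟨hPi, hP'o⟩
  · exact Or.inr ⟨hPo, hP'i⟩
  · exfalso
    obtain ⟨y, hyi, hyPP⟩ := hmeet (inside γ) h.frontier_inside inside_subset_compl_range
    have hyo : y ∈ outside γ := hyPP.elim (fun hy ↦ hPo hy) (fun hy ↦ hP'o hy)
    exact Set.disjoint_left.1 disjoint_inside_outside hyi hyo

/-- **Two preconnected sets on the two sides near a point of the curve lie in different
components**: under the hypotheses of `subset_inside_or_of_nhds`, if `P` meets the inside then
`P ⊆ inside γ` and `P' ⊆ outside γ`. [folklore] -/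
theorem subset_inside_of_nhds_of_inter_nonempty (h : IsJordanLoop γ) {x : ℂ} (hx : x ∈ range γ)
    {V P P' : Set ℂ} (hV : V ∈ 𝓝 x) (hVPP : V \ range γ ⊆ P ∪ P') (hP : IsPreconnected P)
    (hP' : IsPreconnected P') (hPγ : P ⊆ (range γ)ᶜ) (hP'γ : P' ⊆ (range γ)ᶜ)
    (hPi : (P ∩ inside γ).Nonempty) : P ⊆ inside γ ∧ P' ⊆ outside γ := by
  rcases h.subset_inside_or_of_nhds hx hV hVPP hP hP' hPγ hP'γ with h1 | ⟨hPo, -⟩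
  · exact h1
  · exfalso
    obtain ⟨y, hyP, hyi⟩ := hPi
    exact Set.disjoint_left.1 disjoint_inside_outside hyi (hPo hyP)

/-! ### The inside lies in every closed convex set containing the curve -/

/-- **The inside of a Jordan loop lies in the interior of every closed convex set containing the
curve.** [folklore] -/
theorem inside_subset_interior_of_convex (h : IsJordanLoop γ) {K : Set ℂ} (hK : Convex ℝ K)
    (hKc : IsClosed K) (hγK : range γ ⊆ K) : inside γ ⊆ interior K := by
  have h1 : inside γ ⊆ K :=
    (inside_subset_closure_convexHull γ).trans (closure_minimal (convexHull_min hγK hK) hKc)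
  exact (h.isOpen_inside.subset_interior_iff).2 h1

/-- The inside of a Jordan loop running in a closed disc lies in the open disc. [folklore] -/
theorem inside_subset_ball (h : IsJordanLoop γ) {c : ℂ} {R : ℝ} (hγ : range γ ⊆ closedBall c R) :
    inside γ ⊆ ball c R := by
  have := h.inside_subset_interior_of_convex (convex_closedBall c R) isClosed_closedBall hγ
  rcases eq_or_ne R 0 with rfl | hR
  · rw [closedBall_zero, interior_singleton] at this
    exact fun z hz ↦ absurd (this hz) (notMem_empty z)
  · rwa [interior_closedBall c hR] at this

/-! ### A preconnected set leaving the inside meets the curve -/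

/-- **A preconnected set meeting the inside of a Jordan loop and not contained in it meets the
curve.** [folklore] -/
theorem inter_range_nonempty_of_not_subset (h : IsJordanLoop γ) {S : Set ℂ} (hS : IsPreconnected S)
    (h1 : (S ∩ inside γ).Nonempty) (h2 : ¬ S ⊆ inside γ) : (S ∩ range γ).Nonempty := by
  obtain ⟨y, hyS, hy⟩ := not_subset.1 h2
  have := Literature.Algebra.EuclideanLattices.isPreconnected_inter_frontier_nonempty hS h1
    ⟨y, hyS, hy⟩
  rwa [h.frontier_inside] at this

/-- A preconnected set meeting the inside and a point off the closed inside meets the curve; in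
particular a preconnected subset of the complement of the curve meeting the inside lies in the
inside. [folklore] -/
theorem subset_inside_of_inter_nonempty (h : IsJordanLoop γ) {S : Set ℂ} (hS : IsPreconnected S)
    (hSγ : S ⊆ (range γ)ᶜ) (h1 : (S ∩ inside γ).Nonempty) : S ⊆ inside γ := by
  by_contra h2
  obtain ⟨y, hyS, hyγ⟩ := h.inter_range_nonempty_of_not_subset hS h1 h2
  exact hSγ hyS hyγ

/-! ### Jordan loops in a conformal disc -/

/-- **`F - z` has a continuous logarithm on the unit disc** when `F` is continuous on the disc
and omits the value `z` there: contract the disc to its centre (`HasLogOn.of_homotopy`).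
[folklore] -/
theorem _root_.Literature.Topology.PlaneTopology.hasLogOn_sub_of_forall_ne {F : ℂ → ℂ}
    (hF : ContinuousOn F (ball 0 1)) {z : ℂ} (hz : ∀ w ∈ ball (0 : ℂ) 1, F w ≠ z) :
    HasLogOn (fun w ↦ F w - z) (ball 0 1) := by
  -- homotopy `H t w = F (t w) - z` from the constant `F 0 - z` to `F - z`
  have h0 : (0 : ℂ) ∈ ball (0 : ℂ) 1 := mem_ball_self one_pos
  have hmem : ∀ t ∈ Icc (0 : ℝ) 1, ∀ w ∈ ball (0 : ℂ) 1, (t : ℂ) * w ∈ ball (0 : ℂ) 1 := by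
    intro t ht w hw
    rw [mem_ball_zero_iff] at hw ⊢
    rw [norm_mul, Complex.norm_real, Real.norm_eq_abs, abs_of_nonneg ht.1]
    calc t * ‖w‖ ≤ 1 * ‖w‖ := by gcongr; exact ht.2
      _ < 1 := by rw [one_mul]; exact hw
  refine HasLogOn.of_homotopy (f := fun _ ↦ F 0 - z) (fun t w ↦ F ((t : ℂ) * w) - z) ?_
    (fun w _ ↦ by simp) (fun w _ ↦ by simp) (fun t ht w hw ↦ sub_ne_zero.2 (hz _ (hmem t ht w hw)))
    (hasLogOn_const (sub_ne_zero.2 (hz 0 h0)) _)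
  have hc : ContinuousOn (fun p : ℝ × ℂ ↦ ((p.1 : ℂ) * p.2)) (Icc 0 1 ×ˢ ball (0 : ℂ) 1) := by
    fun_prop
  refine (hF.comp hc ?_).sub continuousOn_const
  rintro ⟨t, w⟩ ⟨ht, hw⟩
  exact hmem t ht w hw

/-- **A Jordan loop in a conformal disc winds zero times about exterior points.** Let `F` be
continuous on the open unit disc with values in `Ω`, with a continuous left inverse `ψ : Ω → 𝔻`
(`F (ψ z) = z` on `Ω`; e.g. a conformal map of `𝔻` onto `Ω`). Then a loop in `Ω` has winding
number `0` about every point `z ∉ Ω`. [folklore] -/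
theorem _root_.Literature.Topology.PlaneTopology.wind_sub_eq_zero_of_leftInvOn {Ω : Set ℂ}
    {F ψ : ℂ → ℂ} (hF : ContinuousOn F (ball 0 1)) (hFΩ : MapsTo F (ball 0 1) Ω)
    (hψ : ContinuousOn ψ Ω) (hψb : MapsTo ψ Ω (ball 0 1)) (hFψ : ∀ z ∈ Ω, F (ψ z) = z)
    {γ : ℝ → ℂ} (hγc : ContinuousOn γ (Icc 0 1)) (h01 : γ 0 = γ 1) (hγΩ : MapsTo γ (Icc 0 1) Ω)
    {z : ℂ} (hz : z ∉ Ω) : wind (fun t ↦ γ t - z) = 0 := by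
  have hlog := hasLogOn_sub_of_forall_ne hF (z := z) fun w hw hwz ↦ hz (hwz ▸ hFΩ hw)
  have hw := wind_comp_eq_zero_of_hasLogOn (γ := fun t ↦ ψ (γ t)) hlog (hψ.comp hγc hγΩ)
    (fun t ht ↦ hψb (hγΩ ht)) (by simp [h01])
  rw [← hw]
  refine wind_congr fun t ht ↦ ?_
  simp [Function.comp, hFψ _ (hγΩ ht)]

/-- **A Jordan loop in a conformal disc bounds inside it**: with `F, ψ` as in
`wind_sub_eq_zero_of_leftInvOn`, the inside of every Jordan loop running in `Ω` lies in `Ω`.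
(Points of the inside have winding number `≠ 0`.) [folklore] -/
theorem inside_subset_of_leftInvOn (h : IsJordanLoop γ) {Ω : Set ℂ} {F ψ : ℂ → ℂ}
    (hF : ContinuousOn F (ball 0 1)) (hFΩ : MapsTo F (ball 0 1) Ω) (hψ : ContinuousOn ψ Ω)
    (hψb : MapsTo ψ Ω (ball 0 1)) (hFψ : ∀ z ∈ Ω, F (ψ z) = z) (hγΩ : range γ ⊆ Ω) :
    inside γ ⊆ Ω := by
  intro z hz
  by_contra hzΩ
  have hw := wind_sub_eq_zero_of_leftInvOn hF hFΩ hψ hψb hFψ h.continuous.continuousOn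
    h.eq_zero_one (fun t _ ↦ hγΩ ⟨t, rfl⟩) hzΩ
  exact ((h.mem_inside_iff_wind_ne_zero hz.1).1 hz) hw

/-- With `F, ψ` as above, the closed inside (`inside ∪ range`) of a Jordan loop in `Ω` is a
compact subset of `Ω`. [folklore] -/
theorem closure_inside_subset_of_leftInvOn (h : IsJordanLoop γ) {Ω : Set ℂ} {F ψ : ℂ → ℂ}
    (hF : ContinuousOn F (ball 0 1)) (hFΩ : MapsTo F (ball 0 1) Ω) (hψ : ContinuousOn ψ Ω)
    (hψb : MapsTo ψ Ω (ball 0 1)) (hFψ : ∀ z ∈ Ω, F (ψ z) = z) (hγΩ : range γ ⊆ Ω) :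
    closure (inside γ) ⊆ Ω := by
  rw [h.closure_inside_eq]
  exact union_subset (h.inside_subset_of_leftInvOn hF hFΩ hψ hψb hFψ hγΩ) hγΩ

end IsJordanLoop

end Literature.Topology.PlaneTopology
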